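import Mathlib
import HarnessLib
import Summits.Ventures.LatticeQCDFlow.Scaling.HolonomyNonDeterminationNontrivialGroup
import Summits.Ventures.LatticeQCDFlow.Scaling.NonAbelianSeamHolonomy
import Summits.Ventures.LatticeQCDFlow.Scaling.NonAbelianBianchiTransport
import Summits.Ventures.LatticeQCDFlow.Scaling.StrongCouplingExtensive

/-!
# LatticeQCDFlow / Scaling — two dimensions: the other `L² − 1` plaquettes determine `U_{p₀}` iff the gauge
# group is commutative; lone excited plaquettes exist iff `d = 2` and the group is non-commutative

HONEST FRAMING: exact (Metropolis-corrected) sampling algorithms for lattice gauge theory;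
figures of merit are autocorrelation/cost numbers at stated couplings and volumes; no
continuum-physics claim.

Venture `LatticeQCDFlow` (cell pub-lqcd), topic `Scaling`, FANOUT row 30 (lean-1, GEN-28) — OUR WORK on
THEORY-2.md §4 row C5 (gen25 Q2): the DICHOTOMIES that `Scaling/NonAbelianSeamHolonomy` (two-seam
configurations), `Scaling/NonAbelianBianchiTransport` (no lone excited plaquette in `d ≥ 3`),
`Scaling/AbelianHolonomyDetermination` (`∏_p U_p = 1` for commutative `G`) and
`Scaling/HolonomyNonDeterminationNontrivialGroup` (fewer than `(d−1)(L^d−1)` plaquettes never determine) add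
up to.  On `(ℤ/L)^2` an OPTIMAL ranked structure — the context of the exact one-plaquette heat-bath
autoregression — is all plaquettes but one (`TorusRankedMorseCount.isLeast_card_compl_ranked_two`), so the
question «do the covered holonomies determine the last one?» is «do the other `L² − 1` plaquettes determine
`U_{p₀}`?»:

* §1 **`two_dim_rest_determine_iff_comm`** — `G` ANY group: the holonomies around the other `L² − 1`
  plaquettes determine `U_{p₀}`, for every `p₀` and every pair of configurations, IF AND ONLY IF `G` is
  commutative (`⇐`: `U_{p₀} = (∏_{p≠p₀} U_p)⁻¹`; `⇒`: the two-seam configuration carries `[a,b] ≠ 1` on `p₀`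
  alone);
* §2 **`two_dim_determine_iff`** — `G` any NONTRIVIAL group, `L ≥ 2`, `B ≠ univ` any collection of plaquettes of
  `(ℤ/L)^2`: the holonomies around `B` determine every plaquette holonomy iff `G` is commutative AND
  `#B ≥ L² − 1` (then `B` is all plaquettes but one); in particular (**`two_dim_ranked_determine_iff`**) for a
  RANKED `B` (which misses at least one plaquette, `TorusRankedHomologyBound.one_le_card_compl_of_ranked_two`):
  determination ⇔ `G` commutative ∧ `#B = L² − 1` ⇔ `G` commutative ∧ `B` optimal — for a NON-commutative
  gauge group (`SU(2)`, `SU(3)`) the exact one-plaquette heat-bath autoregression on `(ℤ/L)^2` ALWAYS leaves the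
  uncovered plaquette's holonomy, and even its conjugacy class, free;
* §3 **`exists_lone_plaquette_iff`** — `d ≥ 2`, `L ≥ 2`, `G` any group: a configuration with exactly one
  excited (non-flat) plaquette exists iff `d = 2` and `G` is non-commutative (`d ≥ 3`: the cube transport
  identity; `d = 2` commutative: `∏_p U_p = 1`; `d = 2` non-commutative: the two-seam configuration).

No `def`, no `sorry`, nothing cited as a fact beyond the tree.
-/

namespace Summit.Ventures.LatticeQCDFlow.Theory2.Autoregressive

open Finset
open Literature.MathematicalPhysics.QuantumFieldTheory

variable {d L : ℕ} {G : Type*} [Group G]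

/-! ## §1 The other plaquettes determine `U_{p₀}` iff `G` is commutative -/

/-- For a commutative group (given as a `Group` with commuting multiplication) any one plaquette holonomy is
determined by all the others, in every dimension (`U_{p₀} = (∏_{p≠p₀} U_p)⁻¹`,
`AbelianHolonomyDetermination.plaquetteHolonomy_eq_inv_prod_erase_anyDim`). [ours] -/
theorem rest_determine_of_comm [NeZero L] (hcomm : ∀ a b : G, a * b = b * a) (p₀ : Plaquette d L)
    (U V : GaugeConfig d L G)
    (h : ∀ p : Plaquette d L, p ≠ p₀ → plaquetteHolonomy U p.1 p.2.1.1 p.2.1.2 = plaquetteHolonomy V p.1 p.2.1.1 p.2.1.2) :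
    plaquetteHolonomy U p₀.1 p₀.2.1.1 p₀.2.1.2 = plaquetteHolonomy V p₀.1 p₀.2.1.1 p₀.2.1.2 := by
  classical
  letI : CommGroup G := { (inferInstance : Group G) with mul_comm := hcomm }
  rw [plaquetteHolonomy_eq_inv_prod_erase_anyDim (G := G) U p₀,
    plaquetteHolonomy_eq_inv_prod_erase_anyDim (G := G) V p₀,
    Finset.prod_congr rfl fun p hp => h p (Finset.ne_of_mem_erase hp)]

/-- **TWO DIMENSIONS: THE OTHER `L² − 1` PLAQUETTES DETERMINE `U_{p₀}` IFF `G` IS COMMUTATIVE** (`G` any group,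
`L ≥ 1`). [ours] -/
theorem two_dim_rest_determine_iff_comm [NeZero L] :
    (∀ (p₀ : Plaquette 2 L) (U V : GaugeConfig 2 L G),
        (∀ p : Plaquette 2 L, p ≠ p₀ → plaquetteHolonomy U p.1 p.2.1.1 p.2.1.2 = plaquetteHolonomy V p.1 p.2.1.1 p.2.1.2) →
        plaquetteHolonomy U p₀.1 p₀.2.1.1 p₀.2.1.2 = plaquetteHolonomy V p₀.1 p₀.2.1.1 p₀.2.1.2) ↔
      ∀ a b : G, a * b = b * a := by
  classical
  constructor
  · intro hdet a b
    by_contra hab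
    let p₀ : Plaquette 2 L := (fun _ => 0, ⟨(0, 1), by decide⟩)
    obtain ⟨U, V, hcov, hU, hV, -⟩ := not_determined_two_dim (L := L) hab p₀ (Finset.univ.erase p₀)
      (Finset.notMem_erase p₀ _)
    have h := hdet p₀ U V fun p hp => hcov p (Finset.mem_erase.2 ⟨hp, Finset.mem_univ p⟩)
    rw [hU] at h
    exact hV h.symm
  · intro hcomm p₀ U V h
    exact rest_determine_of_comm hcomm p₀ U V h

/-! ## §2 Which collections of plaquettes of `(ℤ/L)^2` determine the field -/

/-- **WHICH `B` DETERMINE, ON `(ℤ/L)^2`.**  `L ≥ 2`; `G` any group with two elements; `B ≠ univ`.  The holonomies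
around `B` determine every plaquette holonomy of every `G`-configuration iff `G` is commutative and
`#B ≥ L² − 1` (i.e. `B` is all plaquettes but one). [ours] -/
theorem two_dim_determine_iff [NeZero L] [Nontrivial G] (hL : 2 ≤ L) (B : Finset (Plaquette 2 L))
    (hB : B ≠ Finset.univ) :
    (∀ U V : GaugeConfig 2 L G, (∀ p ∈ B, plaquetteHolonomy U p.1 p.2.1.1 p.2.1.2 = plaquetteHolonomy V p.1 p.2.1.1 p.2.1.2) →
        ∀ p' : Plaquette 2 L, plaquetteHolonomy U p'.1 p'.2.1.1 p'.2.1.2 = plaquetteHolonomy V p'.1 p'.2.1.1 p'.2.1.2) ↔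
      (∀ a b : G, a * b = b * a) ∧ L ^ 2 - 1 ≤ B.card := by
  classical
  constructor
  · intro hdet
    refine ⟨fun a b => ?_, ?_⟩
    · by_contra hab
      obtain ⟨p₀, -, hp₀⟩ : ∃ p₀, p₀ ∈ Finset.univ ∧ p₀ ∉ B := by
        by_contra hno
        push Not at hno
        exact hB (Finset.eq_univ_of_forall fun p => hno p (Finset.mem_univ p))
      obtain ⟨U, V, hcov, hU, hV, -⟩ := not_determined_two_dim (L := L) hab p₀ B hp₀
      have h := hdet U V hcov p₀
      rw [hU] at h
      exact hV h.symm
    · by_contra hlt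
      push Not at hlt
      have hlt' : B.card < (2 - 1) * (L ^ 2 - 1) := by omega
      obtain ⟨p', -, U, V, hcov, hp'⟩ := exists_plaquetteHolonomy_not_determined_of_nontrivial hL B hlt' G
      exact hp' (hdet U V hcov p')
  · rintro ⟨hcomm, hcard⟩ U V hcov p'
    by_cases hp' : p' ∈ B
    · exact hcov p' hp'
    · -- `B` is all plaquettes but `p'`
      have hsub : B ⊆ Finset.univ.erase p' := fun p hp =>
        Finset.mem_erase.2 ⟨fun h => hp' (h ▸ hp), Finset.mem_univ p⟩
      have hcard' : (Finset.univ.erase p').card ≤ B.card := by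
        rw [Finset.card_erase_of_mem (Finset.mem_univ p'), Finset.card_univ, Theory2.card_plaquette_two]
        exact hcard
      have hBeq : B = Finset.univ.erase p' := Finset.eq_of_subset_of_card_le hsub hcard'
      refine rest_determine_of_comm hcomm p' U V fun p hp => hcov p ?_
      rw [hBeq]
      exact Finset.mem_erase.2 ⟨hp, Finset.mem_univ p⟩

/-- **RANKED STRUCTURES ON `(ℤ/L)^2`: DETERMINATION ⇔ `G` COMMUTATIVE AND `B` OPTIMAL.**  `L ≥ 2`; `G` any
nontrivial group; `(B, t, rank)` ranked (so `B` misses a plaquette).  The covered holonomies determine every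
plaquette holonomy iff `G` is commutative and `#B = L² − 1` (`= (d−1)(L^d−1)`: `B` optimal) — for a
non-commutative gauge group the exact one-plaquette heat-bath autoregression on `(ℤ/L)^2` always leaves the
uncovered plaquette free (and by `NonAbelianSeamHolonomy.not_determined_two_dim` even its conjugacy class).
[ours] -/
theorem two_dim_ranked_determine_iff [NeZero L] [Nontrivial G] (hL : 2 ≤ L) (B : Finset (Plaquette 2 L))
    (t : Plaquette 2 L → Edge 2 L)
    (ht : ∀ p ∈ B, t p ∈ ({(p.1, p.2.1.1), (p.1.shift p.2.1.1, p.2.1.2),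
        (p.1.shift p.2.1.2, p.2.1.1), (p.1, p.2.1.2)} : Finset (Edge 2 L)))
    (rank : Plaquette 2 L → ℕ)
    (hrank : ∀ p ∈ B, ∀ p' ∈ B, p ≠ p' → t p ∈ ({(p'.1, p'.2.1.1), (p'.1.shift p'.2.1.1, p'.2.1.2),
        (p'.1.shift p'.2.1.2, p'.2.1.1), (p'.1, p'.2.1.2)} : Finset (Edge 2 L)) → rank p < rank p') :
    (∀ U V : GaugeConfig 2 L G, (∀ p ∈ B, plaquetteHolonomy U p.1 p.2.1.1 p.2.1.2 = plaquetteHolonomy V p.1 p.2.1.1 p.2.1.2) →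
        ∀ p' : Plaquette 2 L, plaquetteHolonomy U p'.1 p'.2.1.1 p'.2.1.2 = plaquetteHolonomy V p'.1 p'.2.1.1 p'.2.1.2) ↔
      (∀ a b : G, a * b = b * a) ∧ B.card = L ^ 2 - 1 := by
  classical
  have hcompl := one_le_card_compl_of_ranked_two hL B t ht rank hrank
  have hle := card_le_of_ranked hL B t ht rank hrank
  have hle' : B.card ≤ L ^ 2 - 1 := by simpa using hle
  have hB : B ≠ Finset.univ := by
    intro h
    rw [h, Finset.sdiff_self, Finset.card_empty] at hcompl
    exact absurd hcompl (by norm_num)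
  rw [two_dim_determine_iff hL B hB]
  constructor
  · rintro ⟨hcomm, hcard⟩
    exact ⟨hcomm, le_antisymm hle' hcard⟩
  · rintro ⟨hcomm, hcard⟩
    exact ⟨hcomm, hcard.ge⟩

/-! ## §3 Lone excited plaquettes: iff `d = 2` and `G` non-commutative -/

/-- **A LONE EXCITED PLAQUETTE EXISTS IFF `d = 2` AND THE GAUGE GROUP IS NON-COMMUTATIVE** (`d ≥ 2`, `L ≥ 2`,
`G` any group). [ours] -/
theorem exists_lone_plaquette_iff [NeZero L] (hd : 2 ≤ d) (hL : 2 ≤ L) :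
    (∃ (U : GaugeConfig d L G) (p₀ : Plaquette d L),
        (∀ p : Plaquette d L, p ≠ p₀ → plaquetteHolonomy U p.1 p.2.1.1 p.2.1.2 = 1) ∧
        plaquetteHolonomy U p₀.1 p₀.2.1.1 p₀.2.1.2 ≠ 1) ↔
      d = 2 ∧ ∃ a b : G, a * b ≠ b * a := by
  classical
  constructor
  · rintro ⟨U, p₀, hflat, hp₀⟩
    have hd2 : d = 2 := by
      by_contra hne
      exact hp₀ (no_lone_plaquette_three_le (by omega) hL U p₀ hflat)
    refine ⟨hd2, ?_⟩
    by_contra hno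
    push Not at hno
    letI : CommGroup G := { (inferInstance : Group G) with mul_comm := hno }
    exact hp₀ (no_lone_plaquette_of_comm (H := G) U p₀ hflat)
  · rintro ⟨rfl, a, b, hab⟩
    let p₀ : Plaquette 2 L := (fun _ => 0, ⟨(0, 1), by decide⟩)
    obtain ⟨V, hflat, hV, hne⟩ := exists_lone_plaquette_two_dim (L := L) hab p₀
    exact ⟨V, p₀, hflat, by rw [hV]; exact hne⟩

end Summit.Ventures.LatticeQCDFlow.Theory2.Autoregressive
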